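import Summits.AtomisticToContinuum.BoseEinsteinCondensation.Theses.BECCutLineWeakDisorder
import Literature.MathematicalPhysics.QuantumManyBody.GroundStateFeynmanKacCutLine
import HarnessLib

/-!
# Route `BECCutLineWeakDisorder`, crux `LandscapeBound` (stmt-AtomisticToContinuum-9087):
# vocabulary and stub statements of the line `sibling-telescoping-chaining`

Route-posited objects (D-0016 `<Route>Defs`-style file; precedent
`Theorems/BECCutLineWeakDisorderDefs.lean` of the sibling crux `TwoReplicaTransienceBound`) shared by
the registered stubs of the checked skeleton
`Cruxes/LandscapeBound/Lines/sibling_telescoping_chaining.lean` (line card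
`Cruxes/LandscapeBound/Lines/sibling-telescoping-chaining.md`, idea card
`Cruxes/LandscapeBound/Ideas/sibling-telescoping-chaining.md`) and by the files that prove / compose
them. NOTHING IS ASSERTED here: the objects below are honest definitions over Mathlib and
`GroundStateFeynmanKacCutLine.lean` (`fkWitness`), every `def … : Prop` is a *statement* (a
registered stub signature), consumed only as the type of a stub theorem or as a hypothesis of the
sorry-free composition of the line, and ONE registered bookkeeping stub is PROVED here
(`stub_chaining`, the abstract chaining inequality `chaining_sq`).

**The crux** (`Theses/BECCutLineWeakDisorder.lean`, `def LandscapeBound`): for every repulsive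
finite-range `v`, all small `ρ`, some `C` and all large `N = n + 1`, for EVERY `δ > 0` there is a
NONNEGATIVE `δ`-near-minimiser `Ψ ∈ TrialState (n+1) L`, `L = sideLength ρ (n+1)`, with
`∫ L³ m(Y)²/s(Y)² dY ≤ C` (`m(Y) = ∫ |Ψ(x,Y)|² dx`, `s(Y) = ∫ |Ψ(x,Y)| dx`).

**The line (sibling telescoping + polynomial-Hölder chaining).** On the canonical states of the
route's engine crux `TwoReplicaTransienceBound` (stmt-9687) — the finite-`T` Feynman–Kac witnesses
`Ψ_T = fkWitness v L T 1 = e^{-TH_N}1/‖·‖₂`, uniformly in `T ≥ 1` — tile `[0,L)³ ⊇ Λ_L` dyadically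
with `K = depth L` levels (finest blocks of side `L2^{-K} ∈ (1/4, 1]`, a FIXED unit UV scale). For
the slice `g = |Ψ_T(·,Y)|` put `a_Q = ∫_Q g` (`blockMass`), `S_j = Σ_{|Q| = L2^{-j}} a_Q²`
(`levelSq`), `X_j = 8S_{j+1}/S_j - 1 ∈ [0, 7]` (`siblingExcess`, the `a_Q²`-weighted mean sibling
participation minus one) and `r̄_K = ℓ_K³ m/S_K` (`uvParticipation`). Then slice by slice
`L³ m²/s² ≤ r̄_K · ∏_{j<K} (1 + X_j) · m` (`TelescopeIneq`), and under the slice law `m(Y)dY`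
Cauchy–Schwarz and the generalised-Hölder chaining over the levels (`ChainingIneq`) with the
two-sided weights `holderWeight j k` (`Σ ≤ 1` by Basel twice, `HolderWeightsBound`) bound `E_m[R]`
by `(E_m r̄_K²)^{1/2} · exp(½ Σ θB)` as soon as every level has ONE exponential-moment bound at the
exponent `levelExponent j k = 2/θ_{jk}` inside the budget
`levelBudget A j k = A(2^{-j} + 2^{-k})(λ + λ²)`, whose weighted sum is `≤ A(8 + 32π²)` for every
`K`. Levels with `7 ≤ A(2^{-j} + 2^{-k})(1 + λ_{jk})` are FREE (`X_j ≤ 7`); the content sits in the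
middle octaves.

**Registered stubs** (skeleton `landscapeBound_proof_skeleton`; 3 open + 4 bookkeeping):
* `stub_uvFlatness : UVFlatness` — UV block flatness at the unit scale, second moment under the
  slice law (OPEN);
* `stub_irTailsMiddle : IRTailsMiddle` — per-octave exponential moments of the level-averaged
  sibling excess at the non-free levels (OPEN; the load-bearing stub: with `UVFlatness` it yields
  `TwoReplicaTransienceBound` by name);
* `stub_witnessTransfer : WitnessTransfer` — the route's own crux stmt-AtomisticToContinuum-14978
  by name (`TwoReplicaTransienceBound → LandscapeBound`; OPEN, its own lineage);
* `stub_weights : HolderWeightsBound`, `stub_chaining : ChainingIneq` (proved HERE),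
  `stub_telescope : TelescopeIneq`, `stub_siblingCompose` (the six others ⇒ `LandscapeBound` by
  name) — bookkeeping stubs proved in the lemma / composition files of the line.

References (for the objects, not for any claim): B. Simon, *Schrödinger semigroups*, Bull. AMS 7
(1982) §A1 (A7) (the witnesses `e^{-tH}f/‖e^{-tH}f‖`); E. Bolthausen, CMP 123 (1989) (second moment
of the polymer partition function — the quantity `E_m[R]`).
-/

noncomputable section

open MeasureTheory Filter Set Finset
open scoped ENNReal NNReal Topology BigOperators

namespace Summit.AtomisticToContinuum.BoseEinsteinCondensation.Cruxes.LandscapeBound.SiblingTelescopingChaining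

open Literature.MathematicalPhysics.QuantumManyBody.BoseGas
open Summit.AtomisticToContinuum.BoseEinsteinCondensation.Theses.BECCutLineWeakDisorder

/-! ### Two-sided polynomial Hölder weights -/

/-- Hölder weight of the dyadic level that is `j` octaves below the box (`j = 0`: the eight
octants) and `k` octaves above the UV scale (`j + k + 1 = depth`):
`θ_{jk} = 3/(π²(j+1)²) + 3/(π²(k+1)²)`; `Σ_levels θ ≤ 1` by Basel, twice. -/
def holderWeight (j k : ℕ) : ℝ :=
  3 / (Real.pi ^ 2 * ((j : ℝ) + 1) ^ 2) + 3 / (Real.pi ^ 2 * ((k : ℝ) + 1) ^ 2)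

/-- The exponent at which the level-`(j,k)` sibling excess must have a controlled exponential
moment: `λ_{jk} = 2/θ_{jk} ≤ (2π²/3)·min((j+1)², (k+1)²)` — `O(1)` at the top octaves AND at the
UV end, largest (`≈ π²K²/12`) at the geometric-mean scale. -/
def levelExponent (j k : ℕ) : ℝ := 2 / holderWeight j k

/-- `θ_{jk} > 0`. -/
theorem holderWeight_pos (j k : ℕ) : 0 < holderWeight j k := by
  unfold holderWeight; positivity

/-- `λ_{jk} > 0`. -/
theorem levelExponent_pos (j k : ℕ) : 0 < levelExponent j k := by
  unfold levelExponent; exact div_pos two_pos (holderWeight_pos j k)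

/-- `θ_{jk} λ_{jk} = 2`. -/
theorem holderWeight_mul_levelExponent (j k : ℕ) : holderWeight j k * levelExponent j k = 2 := by
  unfold levelExponent
  rw [mul_div_cancel₀ _ (holderWeight_pos j k).ne']

/-- **The two-sided allowance** of the level that is `j` octaves below the box and `k` octaves
above the UV scale: `A·(2^{-j} + 2^{-k})`. It bounds what the sibling excess may cost at that
level: a part decaying geometrically from the TOP (Dirichlet wall profile — free values
`0, 0.608, 0.123, 0.029, …` from the top at `T ≫ L²`, `≲ c·2^{-j}` uniformly in `T`; triage
T1/T3) plus a part decaying geometrically from the UV scale (interaction-driven excess above the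
healing length, predicted `∝ η(ξ/ℓ)²`, i.e. `4^{-k}`, in `d = 3`; constant per octave in `d = 1`).
Only its summability over levels is used. -/
def allowance (A : ℝ) (j k : ℕ) : ℝ := A * ((2 : ℝ)⁻¹ ^ j + (2 : ℝ)⁻¹ ^ k)

/-- The allowance is nonnegative for `A ≥ 0`. -/
theorem allowance_nonneg {A : ℝ} (hA : 0 ≤ A) (j k : ℕ) : 0 ≤ allowance A j k := by
  unfold allowance; positivity

/-- The log of the allowed exponential moment at level `(j,k)` (sub-exponential tail with mean
AND variance proxy `allowance A j k`, read at the single exponent `λ_{jk}`):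
`B_{jk} = allowance · (λ_{jk} + λ_{jk}²)`. -/
def levelBudget (A : ℝ) (j k : ℕ) : ℝ :=
  allowance A j k * (levelExponent j k + levelExponent j k ^ 2)

/-! ### Dyadic blocks of the box, block masses of a slice -/

/-- Number of dyadic levels used in a box of side `L`: `K = ⌈log₂ ⌈L⌉⌉`, so that the finest
blocks have side `L·2^{-K} ∈ (1/4, 1]` for `L ≥ 1` (`→ (1/2, 1]` as `L → ∞`) — a FIXED,
`N`-independent UV length (the healing length of the gas enters only the constants of the stubs;
triage T2). -/
def depth (L : ℝ) : ℕ := Nat.clog 2 ⌈L⌉₊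

/-- The dyadic block of level `j` (side `L·2^{-j}`) with multi-index `i ∈ {0,…,2^j-1}³`: the
half-open cube `∏_d [L i_d 2^{-j}, L (i_d + 1) 2^{-j})`. Level `0` is `[0, L)³ ⊇ Λ_L`; the `8`
children of a block are the level-`(j+1)` blocks inside it. -/
def dyadicCube (L : ℝ) (j : ℕ) (i : Fin 3 → Fin (2 ^ j)) : Set Space :=
  {x | ∀ d : Fin 3, x d ∈ Set.Ico (L * (i d : ℕ) / 2 ^ j) (L * ((i d : ℕ) + 1) / 2 ^ j)}

/-- Dyadic blocks are measurable (finite intersections of coordinate slabs). -/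
theorem measurableSet_dyadicCube (L : ℝ) (j : ℕ) (i : Fin 3 → Fin (2 ^ j)) :
    MeasurableSet (dyadicCube L j i) := by
  have : dyadicCube L j i = ⋂ d : Fin 3, (fun x : Space => x d) ⁻¹'
      Set.Ico (L * (i d : ℕ) / 2 ^ j) (L * ((i d : ℕ) + 1) / 2 ^ j) := by
    ext x; simp [dyadicCube]
  rw [this]
  exact MeasurableSet.iInter fun d => measurableSet_Ico.preimage (by fun_prop)

/-- `a_Q = ∫_Q g`: the `L¹`-mass of a (slice) function `g ≥ 0` in the block `Q`. -/
def blockMass (g : Space → ℝ≥0∞) (L : ℝ) (j : ℕ) (i : Fin 3 → Fin (2 ^ j)) : ℝ≥0∞ :=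
  ∫⁻ x in dyadicCube L j i, g x

/-- `S_j = Σ_{|Q| = L2^{-j}} a_Q²`: the sum of squared block masses at level `j` (so that
`8^j S_j / s²` is the participation ratio of the coarse-grained slice at level `j`). -/
def levelSq (g : Space → ℝ≥0∞) (L : ℝ) (j : ℕ) : ℝ≥0∞ :=
  ∑ i : Fin 3 → Fin (2 ^ j), blockMass g L j i ^ 2

/-- **UV (within-block) participation at level `K`**: `r̄_K = ℓ_K³ (∫ g²) / S_K`, `ℓ_K = L2^{-K}`
— the `a_Q²`-weighted mean over the level-`K` blocks of the within-block participation ratios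
`ℓ³ ∫_Q g² / (∫_Q g)²`. -/
def uvParticipation (g : Space → ℝ≥0∞) (L : ℝ) (K : ℕ) : ℝ≥0∞ :=
  ENNReal.ofReal ((L / 2 ^ K) ^ 3) * (∫⁻ x, g x ^ 2) / levelSq g L K

/-- **Level-averaged sibling excess** `X_j = 8 S_{j+1}/S_j - 1 (= ⟨σ⟩_j - 1)`: the
`a_Q²`-weighted mean over the level-`j` blocks `Q` of the sibling participations
`σ_Q = 8 Σ_{c ⊂ Q} a_c² / a_Q² ∈ [1, 8]`, minus one (junk `-1` when `S_j ∈ {0, ∞}`). -/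
def siblingExcess (g : Space → ℝ≥0∞) (L : ℝ) (j : ℕ) : ℝ :=
  (8 * levelSq g L (j + 1)).toReal / (levelSq g L j).toReal - 1

/-- The slice `x ↦ |Ψ(x, Y)|` of a real function on `(ℝ³)^{n+1}` at the bath configuration `Y`. -/
def slice {n : ℕ} (Ψ : Config (n + 1) → ℝ) (Y : Config n) (x : Space) : ℝ≥0∞ :=
  (‖Ψ (Matrix.vecCons x Y)‖₊ : ℝ≥0∞)

/-! ### The statements of the line -/

/-- STUB `stub_uvFlatness` — **UV block flatness at the unit scale, second moment under the slice
law.** For admissible `v`, small `ρ`, some `C` and all large `n`, uniformly in `T ≥ 1`: with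
`L = sideLength ρ (n+1)`, `K = depth L` (finest blocks of side `L2^{-K} ∈ (1/4, 1]`),
`Ψ_T = fkWitness v L T 1`, `g_Y = |Ψ_T(·, Y)|`, `m(Y) = ∫ g_Y²`:
`E_m[r̄_K²] = ∫ m(Y) · r̄_K(g_Y)² dY ≤ C`, where `r̄_K = ℓ_K³ m / Σ_{|Q|=ℓ_K} a_Q²` is the
`a_Q²`-weighted mean of the WITHIN-block participation ratios at the fixed UV scale (local:
log-Lipschitz control of the slice at scale `1 ∧ ξ` away from hard cores, no clustering under the
slice law; NOT the crux: one fixed scale, no uniformity in the block number). -/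
def UVFlatness : Prop :=
  ∀ v : ℝ → ℝ≥0∞, IsRepulsiveFiniteRange v → ∃ ρ₀ : ℝ, 0 < ρ₀ ∧ ∀ ρ : ℝ, 0 < ρ → ρ < ρ₀ →
    ∃ C : ℝ, 0 < C ∧ ∀ᶠ n : ℕ in atTop, ∀ T : ℝ, 1 ≤ T →
      ∫⁻ Y : Config n,
          (∫⁻ x, slice (fkWitness (N := n + 1) v (sideLength ρ (n + 1)) T (fun _ => (1 : ℝ≥0∞))) Y x ^ 2) *
            uvParticipation
              (slice (fkWitness (N := n + 1) v (sideLength ρ (n + 1)) T (fun _ => (1 : ℝ≥0∞))) Y)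
              (sideLength ρ (n + 1)) (depth (sideLength ρ (n + 1))) ^ 2 ≤
        ENNReal.ofReal C

/-- STUB `stub_irTailsMiddle` — **per-octave exponential moments of the sibling excess at the
NON-FREE (middle) levels only** (lead reshape v3 of `IRTails`: the same statement, demanded only
where `A (2^{-j} + 2^{-k})(1 + λ_{jk}) < 7`; a level with `7 ≤ A (2^{-j} + 2^{-k})(1 + λ_{jk})` is
FREE — the range bound `X_j ≤ 7` alone gives `E_m e^{λX_j} ≤ e^{7λ} ≤ e^{levelBudget A j k}`
(`levelBound_of_free`, `siblingExcess_le_seven`) — and with `λ_{jk} ≍ min(j,k)²` the free levels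
are the top AND the bottom `≈ log₂ A + 7` octaves, so only the middle of the dyadic range is asked
for). For admissible `v`, small `ρ`, some `A ≥ 0`, eventually
in `n`, uniformly in `T ≥ 1`, for every NON-FREE level `(j, k)`, `j + k + 1 = depth L`:
`∫ m(Y) exp(λ_{jk} X_j(Y)) dY ≤ exp(A(2^{-j} + 2^{-k})(λ_{jk} + λ_{jk}²))`. The content: Gaussian-type
concentration of the level-AVERAGED sibling excess of the slice `|Ψ_T(·,Y)|` under the slice law at
the intermediate scales `1 ≪ ℓ_j ≪ L`, with mean inside the two-sided geometric allowance and
tails at exponent `λ_{jk} ≲ (2π²/3) min(j+1, k+1)²`; the only place uniformity in `N` is spent. -/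
def IRTailsMiddle : Prop :=
  ∀ v : ℝ → ℝ≥0∞, IsRepulsiveFiniteRange v → ∃ ρ₀ : ℝ, 0 < ρ₀ ∧ ∀ ρ : ℝ, 0 < ρ → ρ < ρ₀ →
    ∃ A : ℝ, 0 ≤ A ∧ ∀ᶠ n : ℕ in atTop, ∀ T : ℝ, 1 ≤ T → ∀ j k : ℕ,
      j + k + 1 = depth (sideLength ρ (n + 1)) →
      A * ((2 : ℝ)⁻¹ ^ j + (2 : ℝ)⁻¹ ^ k) * (1 + levelExponent j k) < 7 →
      ∫⁻ Y : Config n,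
          (∫⁻ x, slice (fkWitness (N := n + 1) v (sideLength ρ (n + 1)) T (fun _ => (1 : ℝ≥0∞))) Y x ^ 2) *
            ENNReal.ofReal (Real.exp (levelExponent j k *
              siblingExcess
                (slice (fkWitness (N := n + 1) v (sideLength ρ (n + 1)) T (fun _ => (1 : ℝ≥0∞))) Y)
                (sideLength ρ (n + 1)) j)) ≤
        ENNReal.ofReal (Real.exp (levelBudget A j k))

/-! ### Component statements (registered bookkeeping stubs; proved in the lemma files of the line — `stub_chaining` below) -/

/-- STUB `stub_weights` (PROVED: `sum_holderWeight_le`, `sum_holderWeight_mul_levelBudget_le`) —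
**the two-sided Hölder weights sum to at most one, and the weighted budgets are bounded uniformly
in the depth**: `Σ_{j<K} θ_{j,K-1-j} ≤ 1` and `Σ_{j<K} θ_{j,K-1-j} B_{j,K-1-j} ≤ A(8 + 32π²)` for
every `K` and every `A ≥ 0`. -/
def HolderWeightsBound : Prop :=
  (∀ K : ℕ, ∑ j ∈ Finset.range K, holderWeight j (K - 1 - j) ≤ 1) ∧
  ∀ A : ℝ, 0 ≤ A → ∀ K : ℕ,
    ∑ j ∈ Finset.range K, holderWeight j (K - 1 - j) * levelBudget A j (K - 1 - j) ≤
      A * (8 + 32 * Real.pi ^ 2)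

/-- STUB `stub_chaining` (PROVED: `chaining_sq`) — **chaining with prescribed Hölder weights**
(the recombination engine of the line, abstract form): on a probability space let `X_k ≥ -1`
(`k < K`) be real random variables and `θ_k > 0` weights with `Σ θ_k ≤ 1`; if every level has the
exponential-moment bound `E exp((2/θ_k) X_k) ≤ exp(B_k)`, then `E[(∏_k (1 + X_k))²] ≤ exp(Σ_k θ_k B_k)`. -/
def ChainingIneq : Prop :=
  ∀ (Ω : Type) [MeasurableSpace Ω] (μ : Measure Ω) [IsProbabilityMeasure μ] (K : ℕ)
    (X : Fin K → Ω → ℝ), (∀ k, Measurable (X k)) → (∀ k ω, 0 ≤ 1 + X k ω) →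
    ∀ θ : Fin K → ℝ, (∀ k, 0 < θ k) → ∑ k, θ k ≤ 1 → ∀ B : Fin K → ℝ,
    (∀ k, ∫⁻ ω, ENNReal.ofReal (Real.exp (2 / θ k * X k ω)) ∂μ ≤
      ENNReal.ofReal (Real.exp (B k))) →
    ∫⁻ ω, ENNReal.ofReal ((∏ k, (1 + X k ω)) ^ 2) ∂μ ≤
      ENNReal.ofReal (Real.exp (∑ k, θ k * B k))

/-- STUB `stub_telescope` (PROVED: `siblingExcess_le_seven`, `landscape_le_telescope`) — **the range
bound and the pointwise telescoping bound**: `X_j ≤ 7` for every `g, L, j`, and for `g ≥ 0`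
measurable, bounded, vanishing off `Λ_L` (`L > 0`),
`L³ (∫g²)²/(∫g)² ≤ r̄_K · ∏_{j<K} (1 + X_j) · ∫ g²` for every depth `K`. -/
def TelescopeIneq : Prop :=
  (∀ (g : Space → ℝ≥0∞) (L : ℝ) (j : ℕ), siblingExcess g L j ≤ 7) ∧
  ∀ (g : Space → ℝ≥0∞), Measurable g → ∀ L : ℝ, 0 < L → (∀ x, x ∉ box L → g x = 0) →
    ∀ M : ℝ≥0∞, M ≠ ⊤ → (∀ x, g x ≤ M) → ∀ K : ℕ,
    ENNReal.ofReal (L ^ 3) * (∫⁻ x, g x ^ 2) ^ 2 / (∫⁻ x, g x) ^ 2 ≤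
      uvParticipation g L K *
        ENNReal.ofReal (∏ j ∈ Finset.range K, (1 + siblingExcess g L j)) * ∫⁻ x, g x ^ 2

/-! ### Audit aliases (= the registered stub signatures) -/

namespace Goal

/-- Registered stub `stub_uvFlatness`. -/
abbrev stub_uvFlatness : Prop := UVFlatness

/-- Registered stub `stub_irTailsMiddle` (rank 2, load-bearing; reshape v3 of `stub_irTails`:
non-free levels only). -/
abbrev stub_irTailsMiddle : Prop := IRTailsMiddle

/-- Registered stub `stub_witnessTransfer`: the route's crux stmt-AtomisticToContinuum-14978
`WitnessTransfer` BY NAME (lead reshape, cycle 1). -/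
abbrev stub_witnessTransfer : Prop :=
  Summit.AtomisticToContinuum.BoseEinsteinCondensation.Theses.BECCutLineWeakDisorder.WitnessTransfer

/-- Registered bookkeeping stub `stub_weights` (proved). -/
abbrev stub_weights : Prop := HolderWeightsBound

/-- Registered bookkeeping stub `stub_chaining` (proved). -/
abbrev stub_chaining : Prop := ChainingIneq

/-- Registered bookkeeping stub `stub_telescope` (proved). -/
abbrev stub_telescope : Prop := TelescopeIneq

/-- Registered bookkeeping stub `stub_siblingCompose`: the six stub statements imply the crux
`LandscapeBound` BY NAME (proved below as `stub_siblingCompose`; registered so that the shared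
vocabulary / lemma files of the line land as `--supports` files, precedent
`BECCutLineWeakDisorderDefs.stub_tracerCompose`). -/
abbrev stub_siblingCompose : Prop :=
  stub_weights → stub_chaining → stub_telescope → stub_uvFlatness → stub_irTailsMiddle →
    stub_witnessTransfer →
      Summit.AtomisticToContinuum.BoseEinsteinCondensation.Theses.BECCutLineWeakDisorder.LandscapeBound

end Goal

/-! ### The chaining lemma (generalised Hölder across levels) -/

/-- **Chaining with prescribed Hölder weights** (the recombination engine of the line, abstract
form). On a probability space let `X_k ≥ -1` (`k < K`) be real random variables and `θ_k > 0`
weights with `Σ θ_k ≤ 1`. If every level has the exponential-moment bound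
`E exp((2/θ_k) X_k) ≤ exp(B_k)`, then `E[(∏_k (1 + X_k))²] ≤ exp(Σ_k θ_k B_k)`:
`(∏(1+X))² ≤ exp(2ΣX) = 1^{θ₀} ∏_k (e^{(2/θ_k)X_k})^{θ_k}` pointwise (`1 + x ≤ eˣ`) and the
generalised Hölder inequality with exponents `θ₀ = 1 - Σθ, θ_1, …`. [folklore] -/
theorem chaining_sq {Ω : Type*} [MeasurableSpace Ω] (μ : Measure Ω) [IsProbabilityMeasure μ]
    {K : ℕ} (X : Fin K → Ω → ℝ) (hXm : ∀ k, Measurable (X k)) (hX1 : ∀ k ω, 0 ≤ 1 + X k ω)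
    (θ : Fin K → ℝ) (hθ0 : ∀ k, 0 < θ k) (hθ1 : ∑ k, θ k ≤ 1) (B : Fin K → ℝ)
    (hmgf : ∀ k, ∫⁻ ω, ENNReal.ofReal (Real.exp (2 / θ k * X k ω)) ∂μ ≤
      ENNReal.ofReal (Real.exp (B k))) :
    ∫⁻ ω, ENNReal.ofReal ((∏ k, (1 + X k ω)) ^ 2) ∂μ ≤
      ENNReal.ofReal (Real.exp (∑ k, θ k * B k)) := by
  set θ0 : ℝ := 1 - ∑ k, θ k with hθ0def
  have hθ0nn : 0 ≤ θ0 := by simp only [hθ0def]; linarith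
  set f : Fin K → Ω → ℝ≥0∞ := fun k ω => ENNReal.ofReal (Real.exp (2 / θ k * X k ω)) with hf
  have hfm : ∀ k, Measurable (f k) := fun k =>
    ENNReal.measurable_ofReal.comp (Real.measurable_exp.comp ((hXm k).const_mul _))
  -- pointwise bound
  have hpt : ∀ ω, ENNReal.ofReal ((∏ k, (1 + X k ω)) ^ 2) ≤
      (fun _ => (1:ℝ≥0∞)) ω ^ θ0 * ∏ k, f k ω ^ θ k := by
    intro ω
    have hrhs : ∏ k, f k ω ^ θ k = ENNReal.ofReal (Real.exp (2 * ∑ k, X k ω)) := by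
      simp only [hf]
      rw [Finset.mul_sum, Real.exp_sum,
        ENNReal.ofReal_prod_of_nonneg (fun k _ => (Real.exp_pos _).le)]
      refine Finset.prod_congr rfl fun k _ => ?_
      rw [ENNReal.ofReal_rpow_of_nonneg (Real.exp_pos _).le (hθ0 k).le, ← Real.exp_mul]
      congr 1
      have hθk : θ k ≠ 0 := (hθ0 k).ne'
      field_simp
    rw [hrhs, ENNReal.one_rpow, one_mul]
    apply ENNReal.ofReal_le_ofReal
    have hprod_nn : 0 ≤ ∏ k, (1 + X k ω) := Finset.prod_nonneg fun k _ => hX1 k ω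
    have hle : ∏ k, (1 + X k ω) ≤ Real.exp (∑ k, X k ω) := by
      rw [Real.exp_sum]
      exact Finset.prod_le_prod (fun k _ => hX1 k ω)
        (fun k _ => by linarith [Real.add_one_le_exp (X k ω)])
    calc (∏ k, (1 + X k ω)) ^ 2 ≤ (Real.exp (∑ k, X k ω)) ^ 2 := pow_le_pow_left₀ hprod_nn hle 2
      _ = Real.exp (2 * ∑ k, X k ω) := by rw [← Real.exp_nat_mul]; norm_num
  -- Hölder
  have hHolder : ∫⁻ ω, (fun _ => (1:ℝ≥0∞)) ω ^ θ0 * ∏ k, f k ω ^ θ k ∂μ ≤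
      (∫⁻ ω, (fun _ => (1:ℝ≥0∞)) ω ∂μ) ^ θ0 * ∏ k, (∫⁻ ω, f k ω ∂μ) ^ θ k := by
    refine ENNReal.lintegral_mul_prod_norm_pow_le univ measurable_const.aemeasurable
      (fun k _ => (hfm k).aemeasurable) θ0 ?_ hθ0nn (fun k _ => (hθ0 k).le)
    simp only [hθ0def]; ring
  have hone : (∫⁻ ω, (fun _ => (1:ℝ≥0∞)) ω ∂μ) ^ θ0 = 1 := by
    simp [lintegral_const, measure_univ]
  have hfac : ∀ k : Fin K, (∫⁻ ω, f k ω ∂μ) ^ θ k ≤ ENNReal.ofReal (Real.exp (θ k * B k)) := by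
    intro k
    calc (∫⁻ ω, f k ω ∂μ) ^ θ k ≤ (ENNReal.ofReal (Real.exp (B k))) ^ θ k :=
          ENNReal.rpow_le_rpow (hmgf k) (hθ0 k).le
      _ = ENNReal.ofReal (Real.exp (θ k * B k)) := by
          rw [ENNReal.ofReal_rpow_of_nonneg (Real.exp_pos _).le (hθ0 k).le, ← Real.exp_mul,
            mul_comm]
  calc ∫⁻ ω, ENNReal.ofReal ((∏ k, (1 + X k ω)) ^ 2) ∂μ
      ≤ ∫⁻ ω, (fun _ => (1:ℝ≥0∞)) ω ^ θ0 * ∏ k, f k ω ^ θ k ∂μ := lintegral_mono hpt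
    _ ≤ (∫⁻ ω, (fun _ => (1:ℝ≥0∞)) ω ∂μ) ^ θ0 * ∏ k, (∫⁻ ω, f k ω ∂μ) ^ θ k := hHolder
    _ = ∏ k, (∫⁻ ω, f k ω ∂μ) ^ θ k := by rw [hone, one_mul]
    _ ≤ ∏ k, ENNReal.ofReal (Real.exp (θ k * B k)) :=
        Finset.prod_le_prod (fun k _ => bot_le) (fun k _ => hfac k)
    _ = ENNReal.ofReal (Real.exp (∑ k, θ k * B k)) := by
        rw [Real.exp_sum, ENNReal.ofReal_prod_of_nonneg (fun k _ => (Real.exp_pos _).le)]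

/-! ### The bookkeeping stub proved in this file -/

/-- PROVED bookkeeping stub `stub_chaining` (= `chaining_sq`). -/
theorem stub_chaining : Goal.stub_chaining :=
  fun _ _ μ _ _ X hXm hX1 θ hθ0 hθ1 B hmgf => chaining_sq μ X hXm hX1 θ hθ0 hθ1 B hmgf

end Summit.AtomisticToContinuum.BoseEinsteinCondensation.Cruxes.LandscapeBound.SiblingTelescopingChaining

end
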